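import Summits.HubbardSuperconductivity.HubbardSuperconductivity.Theorems.BcsKacWindowCoherenceWindowLROEnergeticTransfer
import Summits.HubbardSuperconductivity.HubbardSuperconductivity.Theorems.BcsKacWindowCoherenceWindowLROBulkSandwich
import Summits.HubbardSuperconductivity.HubbardSuperconductivity.Theorems.BcsKacWindowCoherenceWindowLROOfParts
import Summits.HubbardSuperconductivity.HubbardSuperconductivity.Theorems.FixedNodeShadowFnEnergyWindow
import Summits.HubbardSuperconductivity.HubbardSuperconductivity.Theses.WeakCouplingBCS
import Summits.HubbardSuperconductivity.HubbardSuperconductivity.Theses.IntrinsicLargeN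

/-!
# STRATEGY CENSUS companion (crux-strategist s2, 2026-08-17) — crux `CoherenceWindowLRO`
(stmt-HubbardSuperconductivity-1319, route `BcsKacWindow`)

Kernel-checked companion of `Cruxes/CoherenceWindowLRO/STRATEGY-CENSUS.md`. Nothing here is a
stub or a line; every theorem is sorry-free and only re-packages LANDED theorems of the tree
(`--supports 1319` files of leads c13–c18, the `IntrinsicLargeN` reduced-BCS anchor items 1657/1660,
`FixedNodeShadow.minEnergyOn_add_smul_concave`). Sections follow the census headings:

* §T Transfer — the Hubbard–Kac `d`-wave PENCIL `K_L(U,g) = hubbardTorus 2 L 1 U + (g/L²)Δ_d†Δ_d`: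
  the solved sibling is `K(0,-g)` (reduced `d`-wave BCS torus: `IntrinsicLargeN.ReducedBCSAnchor`,
  `ReducedBCSEnergyGivesLRO`, both PROVED), the crux lives at `K(U,0)`, the crux's energetic `S⁺`
  (lead c18) compares `K(U,g)` with `K(U,0)` for `g > 0`. `chord_slope_le` (concavity of the sector
  energy in `g`) is the precise statement that energy information on the ATTRACTIVE side `g < 0`
  bounds the pair susceptibility from ABOVE only — the direction the crux does not need.
* §S Strengthen — the three typed `S⁺` with their landed implications `S⁺ → CoherenceWindowLRO`.
* §D Decomposition — the best typed split `(K) ∧ (E)`, glue proved here (`CoherenceWindowLRO_of_subs`);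
  the `birth` split's glue is the landed `coherenceWindowLRO_of_parts`.
* §N Negation — `not_bulkOrderAtBcsRate_of_not_crux`: any counterexample to the crux refutes bulk
  `d_{x²-y²}` order at a BCS rate on a doping interval (the weak-coupling corner of the summit itself).
-/

set_option linter.dupNamespace false

namespace Summit.HubbardSuperconductivity.HubbardSuperconductivity.Cruxes.CoherenceWindowLRO.StrategyCensusS2

open Matrix Literature.MathematicalPhysics.QuantumLattice
open Summit.HubbardSuperconductivity.HubbardSuperconductivity.Theses.BcsKacWindow (CoherenceWindowLRO)
open Summit.HubbardSuperconductivity.HubbardSuperconductivity.Theorems.BcsKacWindow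
open Summit.HubbardSuperconductivity.HubbardSuperconductivity.Theorems.FixedNodeShadow
  (minEnergyOn_add_smul_concave)

/-! ## §T Transfer: the Kac pencil and the one-sidedness of concavity -/

section Pencil

variable {n : Type*} [Fintype n]

/-- **Chord slopes of a concave pencil energy.** For `e(g) := minE_K(A + g•D)` and `g₋ < 0 < g₊`:
`(-g₋)·(e(g₊) - e(0)) ≤ g₊·(e(0) - e(g₋))`, i.e. the right chord slope at `0` is at most the left
chord slope. Read on the Hubbard–Kac pencil (`A = hubbardTorus 2 L 1 U`, `D = Δ_d†Δ_d/L²`): the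
condensation energy of an ATTRACTIVE Kac deformation (`g₋ < 0`, the solved reduced-BCS side) only
bounds the repulsive-side chord — the quantity whose LOWER bound is the crux's energetic `S⁺`
(`coherenceWindowLRO_of_condensationEnergy`) — from ABOVE. [folklore] -/
theorem chord_slope_le (A D : Matrix n n ℂ) (K : Submodule ℂ (n → ℂ))
    (hne : ∃ ψ ∈ K, star ψ ⬝ᵥ ψ = 1) {gm gp : ℝ} (hm : gm < 0) (hp : 0 < gp) :
    (-gm) * ((A + (gp : ℂ) • D).minEnergyOn K - A.minEnergyOn K) ≤
      gp * (A.minEnergyOn K - (A + (gm : ℂ) • D).minEnergyOn K) := by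
  have hden : 0 < gp - gm := by linarith
  set t : ℝ := gp / (gp - gm) with ht_def
  have ht0 : 0 ≤ t := div_nonneg hp.le hden.le
  have ht1 : t ≤ 1 := by
    rw [ht_def, div_le_one hden]; linarith
  have hconc := minEnergyOn_add_smul_concave A D K hne gm gp t ⟨ht0, ht1⟩
  have hzero : t * gm + (1 - t) * gp = 0 := by
    rw [ht_def]; field_simp; ring
  rw [hzero] at hconc
  simp only [Complex.ofReal_zero, zero_smul, add_zero] at hconc
  -- hconc : t * e(gm) + (1 - t) * e(gp) ≤ e(0); multiply by (gp - gm) > 0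
  have h1t : 1 - t = -gm / (gp - gm) := by
    rw [ht_def]; field_simp; ring
  rw [h1t, ht_def] at hconc
  have key := mul_le_mul_of_nonneg_left hconc hden.le
  have e1 : (gp - gm) * (gp / (gp - gm) * (A + (gm : ℂ) • D).minEnergyOn K +
      -gm / (gp - gm) * (A + (gp : ℂ) • D).minEnergyOn K) =
      gp * (A + (gm : ℂ) • D).minEnergyOn K + (-gm) * (A + (gp : ℂ) • D).minEnergyOn K := by
    field_simp
  rw [e1] at key
  nlinarith [key]

end Pencil

/-- **The solved sibling, in the tree (PROVED items 1657 + 1660 of route `IntrinsicLargeN`).**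
Every sector ground state of the reduced `d`-wave BCS torus `K_L(0,-g) = T - (g/L²)Δ_d†Δ_d`
(`T = hubbardTorus 2 L 1 0`) has `d`-wave pair order `≥ (c/g)·L² · L²`-scale for even `L ≥ L₀(g,δ)`:
here only the composition of the two route decls is recorded (both closed by provers). [folklore] -/
theorem sibling_reducedBCS_everyGS_order
    (hA : Summit.HubbardSuperconductivity.HubbardSuperconductivity.Theses.IntrinsicLargeN.ReducedBCSAnchor)
    (hE : Summit.HubbardSuperconductivity.HubbardSuperconductivity.Theses.IntrinsicLargeN.ReducedBCSEnergyGivesLRO)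
    {g : ℝ} (hg : 0 < g) {δ : ℝ} (hδ : δ ∈ Set.Ioo (0 : ℝ) 1) :
    ∃ c : ℝ, 0 < c ∧ ∃ L₀ : ℕ, ∀ (L : ℕ) [NeZero L], L₀ ≤ L → Even L →
      ∀ ψ : Fock (Orb (FermionTorus 2 L)), star ψ ⬝ᵥ ψ = 1 →
        IsGroundStateInSector (hubbardTorus 2 L 1 0 - ((g / (L : ℝ) ^ 2 : ℝ) : ℂ) •
            ((pairField dWaveFormFactor L)ᴴ * pairField dWaveFormFactor L))
          (2 * ⌊(1 - δ) * (L : ℝ) ^ 2 / 2⌋₊) 0 ψ →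
        (L : ℝ) ^ 2 * (c * (L : ℝ) ^ 2) / g ≤
          (star ψ ⬝ᵥ ((pairField dWaveFormFactor L)ᴴ * pairField dWaveFormFactor L) *ᵥ ψ).re := by
  obtain ⟨c, hc, L₀, hL⟩ := hA g hg δ hδ
  refine ⟨c, hc, L₀, fun L _ hL₀ hEv ψ hψ hgs => ?_⟩
  exact hE g hg L _ (c * (L : ℝ) ^ 2) ψ hψ hgs (hL L hL₀ hEv)

/-! ## §S Strengthen: the three typed `S⁺` and their landed implications -/

/-- `S⁺_E` — UNIFORM CONDENSATION-ENERGY COMPARISON on the window tori (lead c18's energetic export;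
hypothesis of `coherenceWindowLRO_of_condensationEnergy`, verbatim). [folklore] -/
def CondensationEnergyComparison : Prop :=
  ∃ (a b κ₁ κ₂ c₀ s₀ g : ℝ) (Δ : ℝ → ℝ), 0 < a ∧ a < b ∧ b < 1 / 2 ∧ 0 < κ₁ ∧ κ₁ ≤ κ₂ ∧
    0 < c₀ ∧ 0 < s₀ ∧ 0 < g ∧
    (∀ U : ℝ, 0 < U → Real.exp (-(κ₂ / U ^ 2)) ≤ Δ U ∧ Δ U ≤ Real.exp (-(κ₁ / U ^ 2))) ∧
    ∀ s : ℝ, s₀ ≤ s → ∃ U₁ : ℝ, 0 < U₁ ∧ ∀ δ ∈ Set.Icc a b, ∀ U ∈ Set.Ioo (0 : ℝ) U₁,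
      ∀ (L : ℕ) [NeZero L], Even L → s₀ ≤ Δ U * L → Δ U * L ≤ s →
        (hubbardTorus 2 L 1 U).minEnergyOn
            (szSector (Λ := FermionTorus 2 L) (2 * ⌊(1 - δ) * (L : ℝ) ^ 2 / 2⌋₊) 0) +
          g * c₀ * Δ U ^ 2 * (L : ℝ) ^ 2 ≤
        (hubbardTorus 2 L 1 U +
            ((g / (L : ℝ) ^ 2 : ℝ) : ℂ) • ((pairField dWaveFormFactor L)ᴴ * pairField dWaveFormFactor L)).minEnergyOn
          (szSector (Λ := FermionTorus 2 L) (2 * ⌊(1 - δ) * (L : ℝ) ^ 2 / 2⌋₊) 0)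

/-- `S⁺_E → crux` (landed, c18). [folklore] -/
theorem crux_of_condensationEnergyComparison : CondensationEnergyComparison → CoherenceWindowLRO :=
  fun h => coherenceWindowLRO_of_condensationEnergy h

/-- `S⁺_B` — BULK `d_{x²-y²}` ORDER AT A BCS RATE on a doping interval (hypothesis of the bulk
sandwich `coherenceWindowLRO_of_bulkLRO_at_bcs_rate`, verbatim; lead c15). [folklore] -/
def BulkOrderAtBcsRate : Prop :=
  ∃ a b κ c C U₀ : ℝ, 0 < a ∧ a < b ∧ b < 1 / 2 ∧ 0 < κ ∧ 0 < c ∧ 0 < C ∧ 0 < U₀ ∧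
    ∀ δ ∈ Set.Icc a b, ∀ U ∈ Set.Ioo (0 : ℝ) U₀, ∀ (L : ℕ) [NeZero L], Even L →
      C * Real.exp (κ / U ^ 2) ≤ L →
        ∀ ψ : Fock (Orb (FermionTorus 2 L)), star ψ ⬝ᵥ ψ = 1 →
          IsGroundStateInSector (hubbardTorus 2 L 1 U) (2 * ⌊(1 - δ) * (L : ℝ) ^ 2 / 2⌋₊) 0 ψ →
            c * Real.exp (-(κ / U ^ 2)) ^ 2 ≤
              (expect ((pairField dWaveFormFactor L)ᴴ * pairField dWaveFormFactor L) ψ).re /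
                (L : ℝ) ^ 4

/-- `S⁺_B → crux` (landed, c15). [folklore] -/
theorem crux_of_bulkOrderAtBcsRate : BulkOrderAtBcsRate → CoherenceWindowLRO :=
  fun h => coherenceWindowLRO_of_bulkLRO_at_bcs_rate h

/-! ## §D Decomposition: the best typed split `(K) ∧ (E)` and its glue -/

/-- Child `(K)` — BYTE-IDENTICAL to the existing item stmt-HubbardSuperconductivity-0158
(`WeakCouplingBCS.WcbcsKohnLuttingerB1g`, open certified computation): `B₁g` leads the `O(U²)`
Kohn–Luttinger kernel by `γU²` on a doping interval. [folklore] -/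
def K : Prop :=
  Summit.HubbardSuperconductivity.HubbardSuperconductivity.Theses.WeakCouplingBCS.WcbcsKohnLuttingerB1g

/-- Child `(E)` — THE ENGINE, conditional on its Kohn–Luttinger input: `(K) → S⁺_E`. This is the
piece that remains the whole analytic crux (finite-volume, source-free weak-coupling construction
below `WeakCouplingCeiling`; programme of stmt-HubbardSuperconductivity-2010). [folklore] -/
def E : Prop := K → CondensationEnergyComparison

/-- Glue of the split, sorry-free: `(K) → (E) → CoherenceWindowLRO` (modus ponens + the landed
energetic transfer). [folklore] -/
theorem CoherenceWindowLRO_of_subs : K → E → CoherenceWindowLRO :=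
  fun hK hE => crux_of_condensationEnergyComparison (hE hK)

/-- Child `A` of the `birth` split — the registered stub `stub_windowCondensate` (mesoscopic
condensate in EVERY window sector ground state, any symmetry: `λ_max(ρ₂(ψ)) ≥ c·Δ(U)·L²`). [folklore] -/
def WindowCondensate : Prop :=
  ∃ (a b κ₁ κ₂ c s₀ : ℝ) (Δ : ℝ → ℝ), 0 < a ∧ a < b ∧ b ≤ 3 / 10 ∧ 0 < κ₁ ∧ κ₁ ≤ κ₂ ∧ 0 < c ∧
    0 < s₀ ∧ (∀ U : ℝ, 0 < U → Real.exp (-(κ₂ / U ^ 2)) ≤ Δ U ∧ Δ U ≤ Real.exp (-(κ₁ / U ^ 2))) ∧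
    ∀ s : ℝ, s₀ ≤ s → ∃ U₁ : ℝ, 0 < U₁ ∧ ∀ δ ∈ Set.Icc a b, ∀ U ∈ Set.Ioo (0 : ℝ) U₁,
      ∀ (L : ℕ) [NeZero L], Even L → s₀ ≤ Δ U * L → Δ U * L ≤ s →
        ∀ ψ : Fock (Orb (FermionTorus 2 L)), star ψ ⬝ᵥ ψ = 1 →
          IsGroundStateInSector (hubbardTorus 2 L 1 U) (2 * ⌊(1 - δ) * (L : ℝ) ^ 2 / 2⌋₊) 0 ψ →
            c * Δ U * (L : ℝ) ^ 2 ≤ (twoParticleRDM ψ).supRayleigh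

/-- Child `B` of the `birth` split — the registered stub `stub_dWaveCoherence` (window-FREE `B₁g`
coherence on `δ ∈ [0, 3/10]`: `c₂·λ_max(ρ₂(ψ))² − C·L² ≤ Re⟨ψ, Δ_d†Δ_d ψ⟩`). [folklore] -/
def DWaveCoherence : Prop :=
  ∃ c₂ C U₀ : ℝ, 0 < c₂ ∧ 0 ≤ C ∧ 0 < U₀ ∧ ∀ δ ∈ Set.Icc (0 : ℝ) (3 / 10),
    ∀ U ∈ Set.Ioo (0 : ℝ) U₀, ∀ (L : ℕ) [NeZero L], Even L →
      ∀ ψ : Fock (Orb (FermionTorus 2 L)), star ψ ⬝ᵥ ψ = 1 →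
        IsGroundStateInSector (hubbardTorus 2 L 1 U) (2 * ⌊(1 - δ) * (L : ℝ) ^ 2 / 2⌋₊) 0 ψ →
          c₂ * (twoParticleRDM ψ).supRayleigh ^ 2 - C * (L : ℝ) ^ 2 ≤
            (expect ((pairField dWaveFormFactor L)ᴴ * pairField dWaveFormFactor L) ψ).re

/-- Glue of the `birth` split (landed by lead c13 as `coherenceWindowLRO_of_parts`, p146802):
`A → B → CoherenceWindowLRO`. [folklore] -/
theorem CoherenceWindowLRO_of_birth : WindowCondensate → DWaveCoherence → CoherenceWindowLRO :=
  fun hA hB => coherenceWindowLRO_of_parts hA hB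

/-! ## §N Negation: where a counterexample would have to live -/

/-- **Any refutation of the crux refutes the weak-coupling corner at BCS rate.** Contrapositive of
the bulk sandwich: `¬ CoherenceWindowLRO → ¬ S⁺_B`. So a counterexample to the typed crux is a proof
that, on EVERY doping interval `[a,b] ⊂ (0,1/2)` and for every rate `κ`, bulk `d_{x²-y²}` pair order
`≥ c·e^{-2κ/U²}` fails for some arbitrarily small `U` on some large even torus — i.e. a refutation
of weak-coupling `d`-wave superconductivity itself (against the Kohn–Luttinger consensus), not of
the window picture. [folklore] -/
theorem not_bulkOrderAtBcsRate_of_not_crux : ¬ CoherenceWindowLRO → ¬ BulkOrderAtBcsRate :=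
  mt crux_of_bulkOrderAtBcsRate

end Summit.HubbardSuperconductivity.HubbardSuperconductivity.Cruxes.CoherenceWindowLRO.StrategyCensusS2
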